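import Summits.QuantumFields.YangMills.Theorems.UnitScaleTiltProp7Growth142T3ChartEL
import HarnessLib

/-!
# Route `UnitScaleTilt`, crux K1 child «MinimiserStabilityRegPr» (stmt-QuantumFields-19200) — ROW E′ (OWNER RULING g24-№3, [Balaban1985Variational] (141)–(142):
# «a critical configuration of (5) in the regular fibre (6)(e) MINIMISES over (6)(e)») IN THE (α)-CURRENCY OF PRINT'S OWN ROUTE, WITH THE FIRST VARIATION (141)
# AND THE THIRD-ORDER TAYLOR ROW DISCHARGED: E′ ⇐ CHART_W^Σ ∧ NORMAL_W ∧ HESS_W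

Cell `ym3-torus`, width seat `ym-ust-19200-w4` (gen 4; payload task = E′ of RULING g24-№3 — documentary since №3′∕№5 — here re-reduced after RULING №25∕№26: the
pinned-representative schema of `PV3E.stub_PV3E_of_relSchemaE` is under the «HGROWTH-PIN» hazard and the un-pinned one under the drift located 2026-08-28 03:06Z;
print's exit is the chart at the critical background, [Balaban1985RegularSpaces] Thm 2 with the average-normalised (1.29) gauge, where (141) is an identity).
THEOREMS ONLY (0 `def`, 0 `sorry`).  YM₃ on T³ is a ladder rung (R3), not the Clay problem; nothing here claims the stub, the crux, d = 4 or the mass gap; E′ is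
NOT closed by this file — it is reduced to three displayed rows of print's Sect. E at the critical background.

THE ARGUMENT (p. 299 «we apply the whole procedure with the configuration U_k instead of U₀ … ⟨A′, J⟩ = 0 … 𝔉(A′) = A(U_k) + ½⟨A′, Δ₁A′⟩ + V(A′) … positive
definite, hence A′ = 0 is a minimum»), for an R2-critical `W ∈ (6)(e) ∩ 𝔅_k(V)` and a competitor `W′ ∈ (6)(e) ∩ 𝔅_k(V)`:
* CHART_W^Σ (displayed): `A(W′) = A(e^{iD}W)` for a Hermitian-traceless `D` with `‖D(b)‖ ≤ s` — Thm 2 at the background `W` charts a gauge copy of `W′`, and (5) is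
  gauge invariant — TOGETHER WITH a Σ_k-curve `γ` through `W` (gauge copies in `𝔅_k(V)` near `t = 0`, bond velocities `ξ`): in print's straightened coordinates
  (47)–(48) the ray `tA′` IS such a curve with velocity `A′`;
* NORMAL_W (displayed): `Σ_b‖iD(b) − ξ(b)‖ ≤ c_N·Σ_b‖D(b)‖²` — the raw coordinate differs from the Σ_k-velocity by print's `H·`(quadratic defect of the log-average),
  [Balaban1985Variational] (47)–(48), [Balaban1985RegularSpaces] (1.91)–(1.92): the constraint-geometry content alone;
* HESS_W (displayed): `κ·Σ_b‖D(b)‖² ≤ q_W(D)` — (116)∕(142), `Δ₁` positive definite on the slice ([Balaban1985BackgroundPropagators] Thm 3.11–3.12, the N06 node);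
* EL_W (THEOREM, `Prop7Growth142T3ChartEL.abs_lin_chart_le_of_sigmaVelocity`): `|ℓ_W(D)| ≤ e·L^{−2(K−n)}·12·Σ_b‖iD(b) − ξ(b)‖ ≤ 12·e·c_N·Σ‖D‖²`;
* TAYLOR3_W (THEOREM, `Prop7Taylor3Word.neg_le_wilsonAction4_expChart_sub_taylor2`): `A(e^{iD}W) − A(W) − ℓ_W(D) − q_W(D) ≥ −4800·s·Σ‖D‖²`;
so `A(W′) − A(W) ≥ (κ − 12·e·c_N − 4800·s)·Σ_b‖D(b)‖² ≥ 0` as soon as `4800s + 12·e·c_N ≤ κ`.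

WHAT IS PROVED (ns `…Theorems.PV3ESigma`).  §1 ★★ `isMinOn_regFibrePr_of_chartRowsSigma_at` (one member, one datum).  §2 ★★★ `stub_PV3E_of_chartRowsSigma`: the E′ TEXT
OF RECORD (verbatim conclusion, `e₅ := e₆`, `a₁'' := 1`; the (7)-datum `ε₁`, the (14)-background `U₀` and the window of E′ are idle — print's statement holds over the whole
regular fibre) from ONE displayed uniform hypothesis: for every `L > 1` constants `e₆ > 0`, `s ∈ [0, ¼]`, `c_N ≥ 0`, `κ` with `4800s + 12e₆c_N ≤ κ`, and the three rows
above at every member, every radius `0 < e ≤ e₆`, every datum `V`, every R2-critical `W ∈ (6)(e) ∩ 𝔅_k(V)` and every competitor.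

HONEST SCOPE.  Bookkeeping over `Prop7Growth142T3ChartEL` (EL) and `Prop7Taylor3Word` (Taylor); CHART_W^Σ, NORMAL_W, HESS_W are DISPLAYED hypotheses = [Balaban1985RegularSpaces]
Thm 2 + [Balaban1985Variational] (47)–(48) + (116) at the critical background (whose (1.33)-regularity is Sect. F ∕ the H side); nothing of print is asserted;
`--supports stmt-QuantumFields-19200`, count-neutral; the registered v8∕v9 row E′ left the skeleton (RULING g24-№3′) and is not re-registered by this file.

References: T. Bałaban, CMP 102 (1985) 277–309 [Balaban1985Variational] ((4)–(7) p.278, (14) p.280, (47)–(48) pp.285–286, (116) p.295, (141)–(142) and Prop. 7 p.299);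
CMP 99 (1985) 75–102 [Balaban1985RegularSpaces] ((1.29) p.81, (1.91)–(1.92) p.91, Thm 2 p.83).
-/

set_option autoImplicit false
noncomputable section

open scoped BigOperators Matrix.Norms.L2Operator Matrix Topology
open Filter

namespace Summit.QuantumFields.YangMills.Theorems.PV3ESigma

open Literature.MathematicalPhysics.QuantumFieldTheory.Balaban1983to89
open Literature.MathematicalPhysics.QuantumFieldTheory.Balaban1983to89.T3ContinuumYM3Torus
open Literature.MathematicalPhysics.QuantumFieldTheory.Balaban1983to89.T3UnitLawDensityEML (ℰp)
open Literature.MathematicalPhysics.QuantumFieldTheory.Balaban1983to89.T3ConstrainedMinimiser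
open Literature.MathematicalPhysics.QuantumFieldTheory.Balaban1983to89.T3Thm1Carrier
open Literature.MathematicalPhysics.QuantumFieldTheory.Balaban1983to89.T3PrintedRegularMinimiser
open Literature.MathematicalPhysics.QuantumFieldTheory.Balaban1983to89.T3RegularMinimiser
open Literature.MathematicalPhysics.QuantumFieldTheory.Balaban1983to89.T3Thm1CarrierNative (IsCritR2)
open Literature.MathematicalPhysics.QuantumFieldTheory.Balaban1983to89.T3SectALandauChart (emb15 CloseAvg pos_of_regPr)
open Summit.QuantumFields.YangMills.Theorems.Prop7TPrint (expHermField)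
open Summit.QuantumFields.YangMills.Theorems.Prop7Taylor3Word (neg_le_wilsonAction4_expChart_sub_taylor2)
open Summit.QuantumFields.YangMills.Theorems.Prop7Growth142T3ChartEL (abs_lin_chart_le_of_sigmaVelocity regThreshold_le_self)

/-! ## §1 Minimality over (6)(e) at an R2-critical point from CHART_W^Σ ∧ NORMAL_W ∧ HESS_W (one member, one datum) -/

/-- ★★ **E′ AT A DATUM IN THE (α)-CURRENCY, (141) AND TAYLOR-3 DISCHARGED.**  Let `W ∈ (6)(e) ∩ 𝔅_k(V)` be R2-critical.  Suppose every competitor `W′ ∈ (6)(e) ∩ 𝔅_k(V)`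
comes with: a Hermitian-traceless chart coordinate `D`, `‖D(b)‖ ≤ s`, `A(W′) = A(e^{iD}W)` (CHART_W^Σ); a Σ_k-curve `γ` through `W` with bond velocities `ξ` and
`Σ_b‖iD(b) − ξ(b)‖ ≤ c_N·Σ_b‖D(b)‖²` (NORMAL_W); and `κ·Σ_b‖D(b)‖² ≤ q_W(D)` (HESS_W).  If `0 ≤ s`, `4s ≤ 1`, `0 ≤ c_N` and `4800s + 12·e·c_N ≤ κ`, then `W` MINIMISES the
Wilson action over (6)(e). [cite: Balaban1985Variational, (141)-(142) p.299, (47)-(48) pp.285-286, (116) p.295] -/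
theorem isMinOn_regFibrePr_of_chartRowsSigma_at (F : T3Family) {n K : ℕ} (h : n ≤ K) {e s cN κ : ℝ}
    (V : GaugeField (F.P n) 0 (Matrix.specialUnitaryGroup (Fin 2) ℂ)) {W : GaugeField (F.P K) 0 (Matrix.specialUnitaryGroup (Fin 2) ℂ)}
    (hW : IsCritR2 F n K h V W) (hWe : W ∈ regFibrePr F n K h e V)
    (hrows : ∀ W' : GaugeField (F.P K) 0 (Matrix.specialUnitaryGroup (Fin 2) ℂ), W' ∈ regFibrePr F n K h e V →
        ∃ (D : PBond (F.P K) 0 → Matrix (Fin 2) (Fin 2) ℂ) (γ : ℝ → GaugeField (F.P K) 0 (Matrix.specialUnitaryGroup (Fin 2) ℂ)) (ξ : PBond (F.P K) 0 → Matrix (Fin 2) (Fin 2) ℂ),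
          (∀ b : PBond (F.P K) 0, (D b).IsHermitian ∧ Matrix.trace (D b) = 0) ∧ (∀ b : PBond (F.P K) 0, ‖D b‖ ≤ s) ∧
          wilsonAction4 W' = wilsonAction4 (emb15 W (expHermField D)) ∧
          γ 0 = W ∧ ContinuousAt γ 0 ∧
          (∀ᶠ t in 𝓝 (0 : ℝ), ∃ u : GaugeTransf (F.P K) 0 (Matrix.specialUnitaryGroup (Fin 2) ℂ), GaugeField.gaugeAct u (γ t) ∈ fibre F ℰp n K h V) ∧
          (∀ b : PBond (F.P K) 0, HasDerivAt (fun t : ℝ => (γ t b : Matrix (Fin 2) (Fin 2) ℂ) * star (W b : Matrix (Fin 2) (Fin 2) ℂ)) (ξ b) 0) ∧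
          (∑ b : PBond (F.P K) 0, ‖Complex.I • D b - ξ b‖ ≤ cN * ∑ b : PBond (F.P K) 0, ‖D b‖ ^ 2) ∧
          κ * ∑ b : PBond (F.P K) 0, ‖D b‖ ^ 2
            ≤ ∑ p : Plaq (F.P K) 0, ((1 / 2) * ‖((Complex.I • D ⟨p.src, p.μ⟩) + ((W ⟨p.src, p.μ⟩ : Matrix (Fin 2) (Fin 2) ℂ) * (Complex.I • D ⟨p.src.shift p.μ, p.ν⟩) * star (W ⟨p.src, p.μ⟩ : Matrix (Fin 2) (Fin 2) ℂ))
            - (((W ⟨p.src, p.μ⟩ * W ⟨p.src.shift p.μ, p.ν⟩ * (W ⟨p.src.shift p.ν, p.μ⟩)⁻¹ : Matrix.specialUnitaryGroup (Fin 2) ℂ) : Matrix (Fin 2) (Fin 2) ℂ) * (Complex.I • D ⟨p.src.shift p.ν, p.μ⟩) * star ((W ⟨p.src, p.μ⟩ * W ⟨p.src.shift p.μ, p.ν⟩ * (W ⟨p.src.shift p.ν, p.μ⟩)⁻¹ : Matrix.specialUnitaryGroup (Fin 2) ℂ) : Matrix (Fin 2) (Fin 2) ℂ))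
            - (((GaugeField.plaqHol W p : Matrix.specialUnitaryGroup (Fin 2) ℂ) : Matrix (Fin 2) (Fin 2) ℂ) * (Complex.I • D ⟨p.src, p.ν⟩) * star ((GaugeField.plaqHol W p : Matrix.specialUnitaryGroup (Fin 2) ℂ) : Matrix (Fin 2) (Fin 2) ℂ)))‖ ^ 2
          + (1 / 2) * (((((GaugeField.plaqHol W p : Matrix.specialUnitaryGroup (Fin 2) ℂ) : Matrix (Fin 2) (Fin 2) ℂ) - 1)ᴴ * (((2 : ℂ)⁻¹ • ((Complex.I • D ⟨p.src, p.μ⟩) ^ 2 + ((W ⟨p.src, p.μ⟩ : Matrix (Fin 2) (Fin 2) ℂ) * (Complex.I • D ⟨p.src.shift p.μ, p.ν⟩) * star (W ⟨p.src, p.μ⟩ : Matrix (Fin 2) (Fin 2) ℂ)) ^ 2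
              + (((W ⟨p.src, p.μ⟩ * W ⟨p.src.shift p.μ, p.ν⟩ * (W ⟨p.src.shift p.ν, p.μ⟩)⁻¹ : Matrix.specialUnitaryGroup (Fin 2) ℂ) : Matrix (Fin 2) (Fin 2) ℂ) * (Complex.I • D ⟨p.src.shift p.ν, p.μ⟩) * star ((W ⟨p.src, p.μ⟩ * W ⟨p.src.shift p.μ, p.ν⟩ * (W ⟨p.src.shift p.ν, p.μ⟩)⁻¹ : Matrix.specialUnitaryGroup (Fin 2) ℂ) : Matrix (Fin 2) (Fin 2) ℂ)) ^ 2
              + (((GaugeField.plaqHol W p : Matrix.specialUnitaryGroup (Fin 2) ℂ) : Matrix (Fin 2) (Fin 2) ℂ) * (Complex.I • D ⟨p.src, p.ν⟩) * star ((GaugeField.plaqHol W p : Matrix.specialUnitaryGroup (Fin 2) ℂ) : Matrix (Fin 2) (Fin 2) ℂ)) ^ 2)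
            + (Complex.I • D ⟨p.src, p.μ⟩) * ((W ⟨p.src, p.μ⟩ : Matrix (Fin 2) (Fin 2) ℂ) * (Complex.I • D ⟨p.src.shift p.μ, p.ν⟩) * star (W ⟨p.src, p.μ⟩ : Matrix (Fin 2) (Fin 2) ℂ))
            - (Complex.I • D ⟨p.src, p.μ⟩) * (((W ⟨p.src, p.μ⟩ * W ⟨p.src.shift p.μ, p.ν⟩ * (W ⟨p.src.shift p.ν, p.μ⟩)⁻¹ : Matrix.specialUnitaryGroup (Fin 2) ℂ) : Matrix (Fin 2) (Fin 2) ℂ) * (Complex.I • D ⟨p.src.shift p.ν, p.μ⟩) * star ((W ⟨p.src, p.μ⟩ * W ⟨p.src.shift p.μ, p.ν⟩ * (W ⟨p.src.shift p.ν, p.μ⟩)⁻¹ : Matrix.specialUnitaryGroup (Fin 2) ℂ) : Matrix (Fin 2) (Fin 2) ℂ))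
            - (Complex.I • D ⟨p.src, p.μ⟩) * (((GaugeField.plaqHol W p : Matrix.specialUnitaryGroup (Fin 2) ℂ) : Matrix (Fin 2) (Fin 2) ℂ) * (Complex.I • D ⟨p.src, p.ν⟩) * star ((GaugeField.plaqHol W p : Matrix.specialUnitaryGroup (Fin 2) ℂ) : Matrix (Fin 2) (Fin 2) ℂ))
            - ((W ⟨p.src, p.μ⟩ : Matrix (Fin 2) (Fin 2) ℂ) * (Complex.I • D ⟨p.src.shift p.μ, p.ν⟩) * star (W ⟨p.src, p.μ⟩ : Matrix (Fin 2) (Fin 2) ℂ))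
                * (((W ⟨p.src, p.μ⟩ * W ⟨p.src.shift p.μ, p.ν⟩ * (W ⟨p.src.shift p.ν, p.μ⟩)⁻¹ : Matrix.specialUnitaryGroup (Fin 2) ℂ) : Matrix (Fin 2) (Fin 2) ℂ) * (Complex.I • D ⟨p.src.shift p.ν, p.μ⟩) * star ((W ⟨p.src, p.μ⟩ * W ⟨p.src.shift p.μ, p.ν⟩ * (W ⟨p.src.shift p.ν, p.μ⟩)⁻¹ : Matrix.specialUnitaryGroup (Fin 2) ℂ) : Matrix (Fin 2) (Fin 2) ℂ))
            - ((W ⟨p.src, p.μ⟩ : Matrix (Fin 2) (Fin 2) ℂ) * (Complex.I • D ⟨p.src.shift p.μ, p.ν⟩) * star (W ⟨p.src, p.μ⟩ : Matrix (Fin 2) (Fin 2) ℂ))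
                * (((GaugeField.plaqHol W p : Matrix.specialUnitaryGroup (Fin 2) ℂ) : Matrix (Fin 2) (Fin 2) ℂ) * (Complex.I • D ⟨p.src, p.ν⟩) * star ((GaugeField.plaqHol W p : Matrix.specialUnitaryGroup (Fin 2) ℂ) : Matrix (Fin 2) (Fin 2) ℂ))
            + (((W ⟨p.src, p.μ⟩ * W ⟨p.src.shift p.μ, p.ν⟩ * (W ⟨p.src.shift p.ν, p.μ⟩)⁻¹ : Matrix.specialUnitaryGroup (Fin 2) ℂ) : Matrix (Fin 2) (Fin 2) ℂ) * (Complex.I • D ⟨p.src.shift p.ν, p.μ⟩) * star ((W ⟨p.src, p.μ⟩ * W ⟨p.src.shift p.μ, p.ν⟩ * (W ⟨p.src.shift p.ν, p.μ⟩)⁻¹ : Matrix.specialUnitaryGroup (Fin 2) ℂ) : Matrix (Fin 2) (Fin 2) ℂ))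
                * (((GaugeField.plaqHol W p : Matrix.specialUnitaryGroup (Fin 2) ℂ) : Matrix (Fin 2) (Fin 2) ℂ) * (Complex.I • D ⟨p.src, p.ν⟩) * star ((GaugeField.plaqHol W p : Matrix.specialUnitaryGroup (Fin 2) ℂ) : Matrix (Fin 2) (Fin 2) ℂ))) * ((GaugeField.plaqHol W p : Matrix.specialUnitaryGroup (Fin 2) ℂ) : Matrix (Fin 2) (Fin 2) ℂ))).trace).re))
    (hs0 : 0 ≤ s) (hs4 : 4 * s ≤ 1) (hcN : 0 ≤ cN) (hκ : 4800 * s + 12 * e * cN ≤ κ) :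
    IsMinOn (fun W' : GaugeField (F.P K) 0 (Matrix.specialUnitaryGroup (Fin 2) ℂ) => wilsonAction4 W') (regFibrePr F n K h e V) W := by
  intro W' hW'
  obtain ⟨D, γ, ξ, hDh, hDs, hA, hγ0, hγc, hγfib, hγξ, hN, hq⟩ := hrows W' hW'
  show wilsonAction4 W ≤ wilsonAction4 W'
  rw [hA]
  have hreg : RegPr F n K e W := ((mem_regFibrePr_iff F).mp hWe).2
  have he0 : 0 < e := pos_of_regPr F hreg
  have hT := neg_le_wilsonAction4_expChart_sub_taylor2 W D hDh hs0 hDs hs4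
  have hEL := abs_lin_chart_le_of_sigmaVelocity hW hWe D γ hγ0 hγc hγfib ξ hγξ
  have hd : ((F.P K).d : ℝ) = 3 := by norm_num [T3Family.P_d]
  rw [hd] at hEL
  have hthr := regThreshold_le_self (F := F) (n := n) (K := K) he0.le
  have hthr0 : 0 ≤ regThreshold F n K e := by unfold regThreshold; positivity
  have hS0 : 0 ≤ ∑ b : PBond (F.P K) 0, ‖D b‖ ^ 2 := Finset.sum_nonneg fun _ _ => sq_nonneg _
  have hN0 : 0 ≤ ∑ b : PBond (F.P K) 0, ‖Complex.I • D b - ξ b‖ := Finset.sum_nonneg fun _ _ => norm_nonneg _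
  -- |ℓ_W(D)| ≤ thr·12·Σ‖iD − ξ‖ ≤ thr·12·c_N·Σ‖D‖² ≤ 12·e·c_N·Σ‖D‖²
  have h1 : regThreshold F n K e * (4 * (3 : ℝ) * ∑ b : PBond (F.P K) 0, ‖Complex.I • D b - ξ b‖)
      ≤ regThreshold F n K e * (12 * (cN * ∑ b : PBond (F.P K) 0, ‖D b‖ ^ 2)) :=
    mul_le_mul_of_nonneg_left (by nlinarith [hN]) hthr0
  have h2 : regThreshold F n K e * (12 * (cN * ∑ b : PBond (F.P K) 0, ‖D b‖ ^ 2))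
      ≤ e * (12 * (cN * ∑ b : PBond (F.P K) 0, ‖D b‖ ^ 2)) :=
    mul_le_mul_of_nonneg_right hthr (by positivity)
  have hEL' := (hEL.trans h1).trans h2
  have habs := (abs_le.mp hEL').1
  have h3 : 0 ≤ (κ - 12 * e * cN - 4800 * s) * ∑ b : PBond (F.P K) 0, ‖D b‖ ^ 2 := mul_nonneg (by linarith) hS0
  nlinarith [hT, habs, hq, h3]

/-! ## §2 The E′ text of record from the uniform displayed rows -/

/-- ★★★ **ROW E′ OF SKELETON v9 (OWNER RULING g24-№3; [Balaban1985Variational] (141)–(142) in print's regime) FROM THE (α)-CURRENCY ROWS CHART_W^Σ ∧ NORMAL_W ∧ HESS_W**,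
uniformly in the member: for every block size `L > 1` there are `e₆ > 0`, `0 ≤ s ≤ ¼`, `c_N ≥ 0` and `κ` with `4800s + 12e₆c_N ≤ κ` such that at every member, every
radius `0 < e ≤ e₆`, every datum `V` and every R2-critical `W ∈ (6)(e) ∩ 𝔅_k(V)` the three rows hold for every competitor of (6)(e) ∩ 𝔅_k(V).  CONCLUSION = the E′ text
verbatim (`e₅ := e₆`, `a₁'' := 1`).  The first variation (141) and the Taylor row are THEOREMS (`Prop7Growth142T3ChartEL`, `Prop7Taylor3Word`); no pinned representative
and no un-pinned drift occur. [cite: Balaban1985Variational, (141)-(142) p.299, Prop. 7 p.299, (4)-(7) p.278, (14) p.280, (47)-(48) pp.285-286, (116) p.295] -/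
theorem stub_PV3E_of_chartRowsSigma
    (hrowsU : ∀ (L : ℕ), 1 < L → ∃ e₆ s cN κ : ℝ, 0 < e₆ ∧ 0 ≤ s ∧ 4 * s ≤ 1 ∧ 0 ≤ cN ∧ 4800 * s + 12 * e₆ * cN ≤ κ ∧
      ∀ (F : T3Family), F.L = L → ∀ (n K : ℕ) (hnK : n < K) (e : ℝ) (V : GaugeField (F.P n) 0 (Matrix.specialUnitaryGroup (Fin 2) ℂ))
        (W : GaugeField (F.P K) 0 (Matrix.specialUnitaryGroup (Fin 2) ℂ)),
        0 < e → e ≤ e₆ → W ∈ regFibrePr F n K hnK.le e V → IsCritR2 F n K hnK.le V W →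
        ∀ W' : GaugeField (F.P K) 0 (Matrix.specialUnitaryGroup (Fin 2) ℂ), W' ∈ regFibrePr F n K hnK.le e V →
          ∃ (D : PBond (F.P K) 0 → Matrix (Fin 2) (Fin 2) ℂ) (γ : ℝ → GaugeField (F.P K) 0 (Matrix.specialUnitaryGroup (Fin 2) ℂ)) (ξ : PBond (F.P K) 0 → Matrix (Fin 2) (Fin 2) ℂ),
            (∀ b : PBond (F.P K) 0, (D b).IsHermitian ∧ Matrix.trace (D b) = 0) ∧ (∀ b : PBond (F.P K) 0, ‖D b‖ ≤ s) ∧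
            wilsonAction4 W' = wilsonAction4 (emb15 W (expHermField D)) ∧
            γ 0 = W ∧ ContinuousAt γ 0 ∧
            (∀ᶠ t in 𝓝 (0 : ℝ), ∃ u : GaugeTransf (F.P K) 0 (Matrix.specialUnitaryGroup (Fin 2) ℂ), GaugeField.gaugeAct u (γ t) ∈ fibre F ℰp n K hnK.le V) ∧
            (∀ b : PBond (F.P K) 0, HasDerivAt (fun t : ℝ => (γ t b : Matrix (Fin 2) (Fin 2) ℂ) * star (W b : Matrix (Fin 2) (Fin 2) ℂ)) (ξ b) 0) ∧
            (∑ b : PBond (F.P K) 0, ‖Complex.I • D b - ξ b‖ ≤ cN * ∑ b : PBond (F.P K) 0, ‖D b‖ ^ 2) ∧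
            κ * ∑ b : PBond (F.P K) 0, ‖D b‖ ^ 2
              ≤ ∑ p : Plaq (F.P K) 0, ((1 / 2) * ‖((Complex.I • D ⟨p.src, p.μ⟩) + ((W ⟨p.src, p.μ⟩ : Matrix (Fin 2) (Fin 2) ℂ) * (Complex.I • D ⟨p.src.shift p.μ, p.ν⟩) * star (W ⟨p.src, p.μ⟩ : Matrix (Fin 2) (Fin 2) ℂ))
            - (((W ⟨p.src, p.μ⟩ * W ⟨p.src.shift p.μ, p.ν⟩ * (W ⟨p.src.shift p.ν, p.μ⟩)⁻¹ : Matrix.specialUnitaryGroup (Fin 2) ℂ) : Matrix (Fin 2) (Fin 2) ℂ) * (Complex.I • D ⟨p.src.shift p.ν, p.μ⟩) * star ((W ⟨p.src, p.μ⟩ * W ⟨p.src.shift p.μ, p.ν⟩ * (W ⟨p.src.shift p.ν, p.μ⟩)⁻¹ : Matrix.specialUnitaryGroup (Fin 2) ℂ) : Matrix (Fin 2) (Fin 2) ℂ))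
            - (((GaugeField.plaqHol W p : Matrix.specialUnitaryGroup (Fin 2) ℂ) : Matrix (Fin 2) (Fin 2) ℂ) * (Complex.I • D ⟨p.src, p.ν⟩) * star ((GaugeField.plaqHol W p : Matrix.specialUnitaryGroup (Fin 2) ℂ) : Matrix (Fin 2) (Fin 2) ℂ)))‖ ^ 2
          + (1 / 2) * (((((GaugeField.plaqHol W p : Matrix.specialUnitaryGroup (Fin 2) ℂ) : Matrix (Fin 2) (Fin 2) ℂ) - 1)ᴴ * (((2 : ℂ)⁻¹ • ((Complex.I • D ⟨p.src, p.μ⟩) ^ 2 + ((W ⟨p.src, p.μ⟩ : Matrix (Fin 2) (Fin 2) ℂ) * (Complex.I • D ⟨p.src.shift p.μ, p.ν⟩) * star (W ⟨p.src, p.μ⟩ : Matrix (Fin 2) (Fin 2) ℂ)) ^ 2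
              + (((W ⟨p.src, p.μ⟩ * W ⟨p.src.shift p.μ, p.ν⟩ * (W ⟨p.src.shift p.ν, p.μ⟩)⁻¹ : Matrix.specialUnitaryGroup (Fin 2) ℂ) : Matrix (Fin 2) (Fin 2) ℂ) * (Complex.I • D ⟨p.src.shift p.ν, p.μ⟩) * star ((W ⟨p.src, p.μ⟩ * W ⟨p.src.shift p.μ, p.ν⟩ * (W ⟨p.src.shift p.ν, p.μ⟩)⁻¹ : Matrix.specialUnitaryGroup (Fin 2) ℂ) : Matrix (Fin 2) (Fin 2) ℂ)) ^ 2
              + (((GaugeField.plaqHol W p : Matrix.specialUnitaryGroup (Fin 2) ℂ) : Matrix (Fin 2) (Fin 2) ℂ) * (Complex.I • D ⟨p.src, p.ν⟩) * star ((GaugeField.plaqHol W p : Matrix.specialUnitaryGroup (Fin 2) ℂ) : Matrix (Fin 2) (Fin 2) ℂ)) ^ 2)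
            + (Complex.I • D ⟨p.src, p.μ⟩) * ((W ⟨p.src, p.μ⟩ : Matrix (Fin 2) (Fin 2) ℂ) * (Complex.I • D ⟨p.src.shift p.μ, p.ν⟩) * star (W ⟨p.src, p.μ⟩ : Matrix (Fin 2) (Fin 2) ℂ))
            - (Complex.I • D ⟨p.src, p.μ⟩) * (((W ⟨p.src, p.μ⟩ * W ⟨p.src.shift p.μ, p.ν⟩ * (W ⟨p.src.shift p.ν, p.μ⟩)⁻¹ : Matrix.specialUnitaryGroup (Fin 2) ℂ) : Matrix (Fin 2) (Fin 2) ℂ) * (Complex.I • D ⟨p.src.shift p.ν, p.μ⟩) * star ((W ⟨p.src, p.μ⟩ * W ⟨p.src.shift p.μ, p.ν⟩ * (W ⟨p.src.shift p.ν, p.μ⟩)⁻¹ : Matrix.specialUnitaryGroup (Fin 2) ℂ) : Matrix (Fin 2) (Fin 2) ℂ))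
            - (Complex.I • D ⟨p.src, p.μ⟩) * (((GaugeField.plaqHol W p : Matrix.specialUnitaryGroup (Fin 2) ℂ) : Matrix (Fin 2) (Fin 2) ℂ) * (Complex.I • D ⟨p.src, p.ν⟩) * star ((GaugeField.plaqHol W p : Matrix.specialUnitaryGroup (Fin 2) ℂ) : Matrix (Fin 2) (Fin 2) ℂ))
            - ((W ⟨p.src, p.μ⟩ : Matrix (Fin 2) (Fin 2) ℂ) * (Complex.I • D ⟨p.src.shift p.μ, p.ν⟩) * star (W ⟨p.src, p.μ⟩ : Matrix (Fin 2) (Fin 2) ℂ))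
                * (((W ⟨p.src, p.μ⟩ * W ⟨p.src.shift p.μ, p.ν⟩ * (W ⟨p.src.shift p.ν, p.μ⟩)⁻¹ : Matrix.specialUnitaryGroup (Fin 2) ℂ) : Matrix (Fin 2) (Fin 2) ℂ) * (Complex.I • D ⟨p.src.shift p.ν, p.μ⟩) * star ((W ⟨p.src, p.μ⟩ * W ⟨p.src.shift p.μ, p.ν⟩ * (W ⟨p.src.shift p.ν, p.μ⟩)⁻¹ : Matrix.specialUnitaryGroup (Fin 2) ℂ) : Matrix (Fin 2) (Fin 2) ℂ))
            - ((W ⟨p.src, p.μ⟩ : Matrix (Fin 2) (Fin 2) ℂ) * (Complex.I • D ⟨p.src.shift p.μ, p.ν⟩) * star (W ⟨p.src, p.μ⟩ : Matrix (Fin 2) (Fin 2) ℂ))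
                * (((GaugeField.plaqHol W p : Matrix.specialUnitaryGroup (Fin 2) ℂ) : Matrix (Fin 2) (Fin 2) ℂ) * (Complex.I • D ⟨p.src, p.ν⟩) * star ((GaugeField.plaqHol W p : Matrix.specialUnitaryGroup (Fin 2) ℂ) : Matrix (Fin 2) (Fin 2) ℂ))
            + (((W ⟨p.src, p.μ⟩ * W ⟨p.src.shift p.μ, p.ν⟩ * (W ⟨p.src.shift p.ν, p.μ⟩)⁻¹ : Matrix.specialUnitaryGroup (Fin 2) ℂ) : Matrix (Fin 2) (Fin 2) ℂ) * (Complex.I • D ⟨p.src.shift p.ν, p.μ⟩) * star ((W ⟨p.src, p.μ⟩ * W ⟨p.src.shift p.μ, p.ν⟩ * (W ⟨p.src.shift p.ν, p.μ⟩)⁻¹ : Matrix.specialUnitaryGroup (Fin 2) ℂ) : Matrix (Fin 2) (Fin 2) ℂ))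
                * (((GaugeField.plaqHol W p : Matrix.specialUnitaryGroup (Fin 2) ℂ) : Matrix (Fin 2) (Fin 2) ℂ) * (Complex.I • D ⟨p.src, p.ν⟩) * star ((GaugeField.plaqHol W p : Matrix.specialUnitaryGroup (Fin 2) ℂ) : Matrix (Fin 2) (Fin 2) ℂ))) * ((GaugeField.plaqHol W p : Matrix.specialUnitaryGroup (Fin 2) ℂ) : Matrix (Fin 2) (Fin 2) ℂ))).trace).re)) :
    ∀ (L : ℕ), 1 < L → ∀ (B₃ : ℝ), 4 < B₃ →
    ∃ e₅ a₁'' : ℝ, 0 < e₅ ∧ 0 < a₁'' ∧ ∀ (i : Idx L) (e ε₁ : ℝ) (V : GaugeField (i.1.1.P i.1.2.1) 0 (Matrix.specialUnitaryGroup (Fin 2) ℂ))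
      (U₀ W : GaugeField (i.1.1.P i.1.2.2) 0 (Matrix.specialUnitaryGroup (Fin 2) ℂ)),
      0 < ε₁ → ε₁ ≤ a₁'' → PlaqSmall ε₁ V → (L : ℝ) ^ 3 * B₃ * ε₁ ≤ e → e ≤ e₅ →
      RegPr i.1.1 i.1.2.1 i.1.2.2 ((L : ℝ) ^ 3 * B₃ * ε₁) U₀ → CloseAvg i.1.1 i.1.2.1 i.1.2.2 i.2.2.le ((L : ℝ) ^ 3 * ε₁) V U₀ →
      W ∈ regFibrePr i.1.1 i.1.2.1 i.1.2.2 i.2.2.le e V → IsCritR2 i.1.1 i.1.2.1 i.1.2.2 i.2.2.le V W →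
        IsMinOn (fun W' : GaugeField (i.1.1.P i.1.2.2) 0 (Matrix.specialUnitaryGroup (Fin 2) ℂ) => wilsonAction4 W')
          (regFibrePr i.1.1 i.1.2.1 i.1.2.2 i.2.2.le e V) W := by
  intro L hL B₃ hB₃
  obtain ⟨e₆, s, cN, κ, he₆, hs0, hs4, hcN, hκ, H⟩ := hrowsU L hL
  refine ⟨e₆, 1, he₆, one_pos, ?_⟩
  intro i e ε₁ V U₀ W hε₁ _hε₁a _hV hlo hhi _hRU₀ _hclose hW hWcrit
  obtain ⟨⟨F, n, K⟩, hF, hnK⟩ := i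
  have hL0 : (0 : ℝ) < (L : ℝ) := by exact_mod_cast (show 0 < L by omega)
  have he0 : 0 < e := lt_of_lt_of_le (by positivity) hlo
  have hκe : 4800 * s + 12 * e * cN ≤ κ := by nlinarith [hhi, hcN]
  exact isMinOn_regFibrePr_of_chartRowsSigma_at F hnK.le V hWcrit hW (H F hF n K hnK e V W he0 hhi hW hWcrit) hs0 hs4 hcN hκe

end Summit.QuantumFields.YangMills.Theorems.PV3ESigma

end
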